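import Summits.CriticalPhenomena.PercolationContinuityZ3.Theorems.PercNearOneGluingNoHeavyLowerTailFKHullPortTADefs
import Summits.CriticalPhenomena.PercolationContinuityZ3.Theorems.PercNearOneGluingNoHeavyLowerTailHullPortTASections
import HarnessLib

/-!
# FK sub-lane: one-pair sections of the hull-port functionals for `φ_{𝐩,q}` (deletion / contraction)

Support file (`--supports stmt-CriticalPhenomena-4575`), FK sub-lane `prim-bschramm-fk-2` (gen 3); builds on p205010 (kernel theorem,
internal audit signed; external expert review pending).  No definitions, no named facts, no sorries; standard axioms.

Random-cluster version of prove-5's `…HullPortTASections.lean` for the functionals `FK.taB, FK.taA, FK.tab, FK.taa` of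
`…FKHullPortTADefs.lean` (bschramm/FK-Q2.md §12.1–12.2, §12.7 L-b):
* `FK.rcWeightW_affine` — the random-cluster weight is affine in each edge parameter, POINTWISE in the configuration:
  `w_q(ω) = (1 − w e)·w_q[e↦0](ω) + (w e)·w_q[e↦1](ω)` (the factor `q^{k(ω)}` is common; simpler than the product-measure
  resampling because no configuration is shifted);
* `FK.taB_absorb` etc. — if the pair `e = s(x₀,v)`, `x₀ ∈ X`, has parameter `1` (it is almost surely open), adding `v` to the
  avoided set `X` changes none of the functionals: `(w[e↦1], X ∪ {v})` IS the contraction `G/e` (honest contraction, no tilt);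
* the SECTION IDENTITIES `Φ_X(w) = (1 − w e)·Φ_X(w[e↦0]) + (w e)·Φ_{X∪{v}}(w[e↦1])` for `Φ ∈ {taB, taA, tab, taa}` — deletion and
  contraction endpoints of the one-edge deformation of prim-hp-7's `T_A` argument (HP7-MDLX-PROOF §3) for `φ_{𝐩,q}`.
[cite: Grimmett2006, §1.4 eq. (1.20) (p. 15); Thm. (3.1)(a) (p. 37)] [cite: VandenbergHaggstromKahn2005, §2.1 Lemma 2.3 (p. 10)]
-/

noncomputable section

namespace Summit.CriticalPhenomena.PercolationContinuityZ3.Theorems.FK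

open MeasureTheory Set Literature.Probability.LatticeModels Literature.Probability.Percolation
open Literature.Probability.Percolation.DecisionTree (ind ind_of_mem ind_of_not_mem ind_nonneg)
open Literature.Probability.Percolation.BHK2006 (rcMass delW)
open Summit.CriticalPhenomena.PercolationContinuityZ3.Theorems.HullPort (cut avoidEv)
open scoped Classical

variable {V : Type*} [Fintype V]

section Sections

open Literature.Probability.Percolation.BHK2006 (weight)
open Summit.CriticalPhenomena.PercolationContinuityZ3.Theorems.HullPort (insert_mem_avoidEv_iff cut_insert_edge edge_mem_cut)

omit [Fintype V] in
/-- The real coordinates of an updated weight vector. [folklore] -/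
theorem coe_update (w : Sym2 V → unitInterval) (e f : Sym2 V) (c : unitInterval) :
    ((Function.update w e c f : unitInterval) : ℝ) = if f = e then (c : ℝ) else (w f : ℝ) := by
  by_cases h : f = e
  · subst h; simp
  · simp [h]

/-- **One-coordinate affine decomposition of the random-cluster weight**: for every configuration `ω`,
`w_q(ω) = (1 − w e)·w_q[e↦0](ω) + (w e)·w_q[e↦1](ω)` (the factor `q^{k(ω)}` is common). [cite: Grimmett2006, §1.4 eq. (1.20) (p. 15); Thm. (3.1)(a)] -/
theorem rcWeightW_affine (w : Sym2 V → unitInterval) (q : ℝ) (B : Set V) (e : Sym2 V) (ω : BondConfig V) :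
    rcWeightW w q B ω = (1 - (w e : ℝ)) * rcWeightW (Function.update w e 0) q B ω +
      (w e : ℝ) * rcWeightW (Function.update w e 1) q B ω := by
  classical
  unfold rcWeightW weight
  set R : ℝ := ∏ f ∈ Finset.univ.erase e, (if f ∈ ω then ((w f : unitInterval) : ℝ) else 1 - (w f : ℝ)) with hR
  have hfac : ∀ (u : Sym2 V → unitInterval), (∀ f, f ≠ e → u f = w f) →
      (∏ f, (if f ∈ ω then ((u f : unitInterval) : ℝ) else 1 - (u f : ℝ))) =
        (if e ∈ ω then ((u e : unitInterval) : ℝ) else 1 - (u e : ℝ)) * R := by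
    intro u hu
    rw [← Finset.mul_prod_erase Finset.univ _ (Finset.mem_univ e)]
    congr 1
    refine Finset.prod_congr rfl fun f hf => ?_
    rw [hu f (Finset.ne_of_mem_erase hf)]
  rw [hfac w (fun f _ => rfl), hfac (Function.update w e 0) (fun f hf => Function.update_of_ne hf _ _),
    hfac (Function.update w e 1) (fun f hf => Function.update_of_ne hf _ _)]
  simp only [Function.update_self]
  by_cases he : e ∈ ω
  · simp only [if_pos he]
    push_cast
    ring
  · simp only [if_neg he]
    push_cast
    ring

/-- A weight-1 pair that is closed kills the random-cluster weight. [cite: Grimmett2006, §1.4 eq. (1.20) (p. 15)] -/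
theorem rcWeightW_eq_zero_of_one_not_mem (w : Sym2 V → unitInterval) (q : ℝ) (B : Set V) {e : Sym2 V} {ω : BondConfig V}
    (h1 : (w e : ℝ) = 1) (he : e ∉ ω) : rcWeightW w q B ω = 0 := by
  classical
  unfold rcWeightW weight
  rw [Finset.prod_eq_zero (Finset.mem_univ e) (by simp only [if_neg he, h1]; ring), zero_mul]

/-- A weight-0 pair that is open kills the random-cluster weight. [cite: Grimmett2006, §1.4 eq. (1.20) (p. 15)] -/
theorem rcWeightW_eq_zero_of_zero_mem (w : Sym2 V → unitInterval) (q : ℝ) (B : Set V) {e : Sym2 V} {ω : BondConfig V}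
    (h0 : (w e : ℝ) = 0) (he : e ∈ ω) : rcWeightW w q B ω = 0 := by
  classical
  unfold rcWeightW weight
  rw [Finset.prod_eq_zero (Finset.mem_univ e) (by simp only [if_pos he, h0]), zero_mul]

omit [Fintype V] in
/-- Deleting the pairs of `B` does not see the parameters on `B`. [cite: VandenbergHaggstromKahn2005, §2.1 Lemma 2.3 (p. 10)] -/
theorem delW_congr_off {w w' : Sym2 V → unitInterval} {B : Set (Sym2 V)} (h : ∀ e ∉ B, w e = w' e) :
    delW w B = delW w' B := by
  funext e
  unfold delW
  by_cases he : e ∈ B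
  · rw [if_pos he, if_pos he]
  · rw [if_neg he, if_neg he, h e he]

/-- A world expectation does not see the parameters of the deleted pairs. [cite: VandenbergHaggstromKahn2005, §2.1 Lemma 2.3 (p. 10)] -/
theorem wE_congr_off {w w' : Sym2 V → unitInterval} (q : ℝ) {B : Set (Sym2 V)} (h : ∀ e ∉ B, w e = w' e)
    (φ : Set (Sym2 V) → ℝ) : wE w q B φ = wE w' q B φ := by
  unfold wE
  rw [delW_congr_off h]

/-- `c` does not see the parameters of the cut pairs. [cite: VandenbergHaggstromKahn2005, §2.1 Lemma 2.3 (p. 10)] -/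
theorem taC_congr_off {w w' : Sym2 V → unitInterval} (q : ℝ) (s y : V) (X : Set V) (g : Set (Sym2 V) → ℝ)
    {ω : Set (Sym2 V)} (h : ∀ e ∉ cut X ω, w e = w' e) : taC w q s y X g ω = taC w' q s y X g ω := by
  unfold taC
  rw [wE_congr_off q h, wE_congr_off q h, wE_congr_off q h]

/-- `taN` does not see the parameters of the cut pairs. [cite: VandenbergHaggstromKahn2005, §2.1 Lemma 2.3 (p. 10)] -/
theorem taN_congr_off {w w' : Sym2 V → unitInterval} (q : ℝ) (s y : V) (X : Set V)
    {ω : Set (Sym2 V)} (h : ∀ e ∉ cut X ω, w e = w' e) : taN w q s y X ω = taN w' q s y X ω := by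
  unfold taN
  rw [wE_congr_off q h]

/-- `taNW` does not see the parameters of the cut pairs. [cite: VandenbergHaggstromKahn2005, §2.1 Lemma 2.3 (p. 10)] -/
theorem taNW_congr_off {w w' : Sym2 V → unitInterval} (q : ℝ) (s y z : V) (X : Set V)
    {ω : Set (Sym2 V)} (h : ∀ e ∉ cut X ω, w e = w' e) : taNW w q s y z X ω = taNW w' q s y z X ω := by
  unfold taNW
  rw [wE_congr_off q h]

omit [Fintype V] in
/-- Off the pair `e`, the updated weight vectors agree with `w`; `e` lies in every cut set of `X ∋ x₀`. [folklore] -/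
theorem update_eq_off_cut (w : Sym2 V → unitInterval) (x₀ v : V) (X : Set V) (hx₀ : x₀ ∈ X) (c : unitInterval)
    (ω : Set (Sym2 V)) : ∀ f ∉ cut X ω, w f = Function.update w s(x₀, v) c f := by
  intro f hf
  have hfe : f ≠ s(x₀, v) := fun h => hf (h ▸ edge_mem_cut x₀ v X hx₀ ω)
  rw [Function.update_of_ne hfe]

/-- **Absorption**: if the pair `e = s(x₀,v)` (`x₀ ∈ X`) has parameter `1`, adding `v` to the avoided set changes nothing in `B`
(configurations with `e` closed have weight `0`; with `e` open the cut set and the avoidance of `X ∪ {v}` are those of `X`).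
[cite: Grimmett2006, §1.4 eq. (1.20) (p. 15)] -/
theorem taB_absorb (w : Sym2 V → unitInterval) (q : ℝ) (s y x₀ v : V) (X : Set V) (hx₀ : x₀ ∈ X)
    (h1 : (w s(x₀, v) : ℝ) = 1) (g : Set (Sym2 V) → ℝ) : taB w q s y (insert v X) g = taB w q s y X g := by
  unfold taB
  refine Finset.sum_congr rfl fun ω _ => ?_
  by_cases he : s(x₀, v) ∈ ω
  · have hω : insert s(x₀, v) ω = ω := Set.insert_eq_of_mem he
    have hcut : cut (insert v X) ω = cut X ω := by rw [← cut_insert_edge x₀ v X hx₀ ω, hω]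
    have hav : ind (avoidEv s (insert v X)) ω = ind (avoidEv s X) ω := by
      by_cases h : ω ∈ avoidEv s (insert v X)
      · rw [ind_of_mem h, ind_of_mem (hω ▸ (insert_mem_avoidEv_iff s x₀ v X hx₀ ω).2 h)]
      · rw [ind_of_not_mem h, ind_of_not_mem fun h' => h ((insert_mem_avoidEv_iff s x₀ v X hx₀ ω).1 (hω.symm ▸ h'))]
    have hC : taC w q s y (insert v X) g ω = taC w q s y X g ω := by
      unfold taC; rw [hcut]
    rw [hav, hC]
  · rw [rcWeightW_eq_zero_of_one_not_mem w q ∅ h1 he, zero_mul, zero_mul]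

/-- Absorption for `A`. [cite: Grimmett2006, §1.4 eq. (1.20) (p. 15)] -/
theorem taA_absorb (w : Sym2 V → unitInterval) (q : ℝ) (s y z x₀ v : V) (X : Set V) (hx₀ : x₀ ∈ X)
    (h1 : (w s(x₀, v) : ℝ) = 1) (g : Set (Sym2 V) → ℝ) : taA w q s y z (insert v X) g = taA w q s y z X g := by
  unfold taA
  refine Finset.sum_congr rfl fun ω _ => ?_
  by_cases he : s(x₀, v) ∈ ω
  · have hω : insert s(x₀, v) ω = ω := Set.insert_eq_of_mem he
    have hcut : cut (insert v X) ω = cut X ω := by rw [← cut_insert_edge x₀ v X hx₀ ω, hω]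
    have hav : ind (avoidEv s (insert v X)) ω = ind (avoidEv s X) ω := by
      by_cases h : ω ∈ avoidEv s (insert v X)
      · rw [ind_of_mem h, ind_of_mem (hω ▸ (insert_mem_avoidEv_iff s x₀ v X hx₀ ω).2 h)]
      · rw [ind_of_not_mem h, ind_of_not_mem fun h' => h ((insert_mem_avoidEv_iff s x₀ v X hx₀ ω).1 (hω.symm ▸ h'))]
    have hC : taC w q s y (insert v X) g ω = taC w q s y X g ω := by unfold taC; rw [hcut]
    have hN : taN w q s y (insert v X) ω = taN w q s y X ω := by unfold taN; rw [hcut]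
    have hNW : taNW w q s y z (insert v X) ω = taNW w q s y z X ω := by unfold taNW; rw [hcut]
    rw [hav, hC, hN, hNW]
  · rw [rcWeightW_eq_zero_of_one_not_mem w q ∅ h1 he, zero_mul, zero_mul]

/-- Absorption for `b`. [cite: Grimmett2006, §1.4 eq. (1.20) (p. 15)] -/
theorem tab_absorb (w : Sym2 V → unitInterval) (q : ℝ) (s y x₀ v : V) (X : Set V) (hx₀ : x₀ ∈ X)
    (h1 : (w s(x₀, v) : ℝ) = 1) : tab w q s y (insert v X) = tab w q s y X := by
  unfold tab
  refine Finset.sum_congr rfl fun ω _ => ?_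
  by_cases he : s(x₀, v) ∈ ω
  · have hω : insert s(x₀, v) ω = ω := Set.insert_eq_of_mem he
    have hx₀' : x₀ ∈ insert s X := Set.mem_insert_of_mem _ hx₀
    have hav : ind (avoidEv y (insert s (insert v X))) ω = ind (avoidEv y (insert s X)) ω := by
      rw [Set.insert_comm]
      by_cases h : ω ∈ avoidEv y (insert v (insert s X))
      · rw [ind_of_mem h, ind_of_mem (hω ▸ (insert_mem_avoidEv_iff y x₀ v (insert s X) hx₀' ω).2 h)]
      · rw [ind_of_not_mem h, ind_of_not_mem fun h' =>
          h ((insert_mem_avoidEv_iff y x₀ v (insert s X) hx₀' ω).1 (hω.symm ▸ h'))]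
    rw [hav]
  · rw [rcWeightW_eq_zero_of_one_not_mem w q ∅ h1 he, zero_mul, zero_mul]

/-- Absorption for `a`. [cite: Grimmett2006, §1.4 eq. (1.20) (p. 15)] -/
theorem taa_absorb (w : Sym2 V → unitInterval) (q : ℝ) (s y z x₀ v : V) (X : Set V) (hx₀ : x₀ ∈ X)
    (h1 : (w s(x₀, v) : ℝ) = 1) : taa w q s y z (insert v X) = taa w q s y z X := by
  unfold taa
  refine Finset.sum_congr rfl fun ω _ => ?_
  by_cases he : s(x₀, v) ∈ ω
  · have hω : insert s(x₀, v) ω = ω := Set.insert_eq_of_mem he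
    have hx₀' : x₀ ∈ insert s X := Set.mem_insert_of_mem _ hx₀
    have hav : ω ∈ avoidEv y (insert s (insert v X)) ↔ ω ∈ avoidEv y (insert s X) := by
      rw [Set.insert_comm]
      constructor
      · intro h; exact hω ▸ (insert_mem_avoidEv_iff y x₀ v (insert s X) hx₀' ω).2 h
      · intro h'; exact (insert_mem_avoidEv_iff y x₀ v (insert s X) hx₀' ω).1 (hω.symm ▸ h')
    have hind : ind (avoidEv y (insert s (insert v X)) ∩ openConn y z) ω = ind (avoidEv y (insert s X) ∩ openConn y z) ω := by
      by_cases h : ω ∈ avoidEv y (insert s X) ∩ openConn y z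
      · rw [ind_of_mem h, ind_of_mem (Set.mem_inter (hav.2 h.1) h.2)]
      · rw [ind_of_not_mem h, ind_of_not_mem fun h' => h (Set.mem_inter (hav.1 h'.1) h'.2)]
    rw [hind]
  · rw [rcWeightW_eq_zero_of_one_not_mem w q ∅ h1 he, zero_mul, zero_mul]

/-- **Section identity for `B` (random-cluster weights)**: along the pair `e = s(x₀,v)`, `x₀ ∈ X`,
`B_X(w) = (1 − w e)·B_X(w[e↦0]) + (w e)·B_{X∪{v}}(w[e↦1])` — deletion and contraction of `e`.
(FK form of prove-5's `HullPort.taB_section`; bschramm/FK-Q2.md §12.2) [cite: Grimmett2006, Thm. (3.1)(a), eq. (1.20)] -/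
theorem taB_sectionFK (w : Sym2 V → unitInterval) (q : ℝ) (s y x₀ v : V) (X : Set V) (hx₀ : x₀ ∈ X)
    (g : Set (Sym2 V) → ℝ) :
    taB w q s y X g = (1 - (w s(x₀, v) : ℝ)) * taB (Function.update w s(x₀, v) 0) q s y X g +
      (w s(x₀, v) : ℝ) * taB (Function.update w s(x₀, v) 1) q s y (insert v X) g := by
  rw [taB_absorb (Function.update w s(x₀, v) 1) q s y x₀ v X hx₀ (by simp) g]
  unfold taB
  rw [Finset.mul_sum, Finset.mul_sum, ← Finset.sum_add_distrib]
  refine Finset.sum_congr rfl fun ω _ => ?_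
  rw [rcWeightW_affine w q ∅ s(x₀, v) ω,
    ← taC_congr_off q s y X g (update_eq_off_cut w x₀ v X hx₀ 0 ω),
    ← taC_congr_off q s y X g (update_eq_off_cut w x₀ v X hx₀ 1 ω)]
  ring

/-- Section identity for `A` (random-cluster weights). [cite: Grimmett2006, Thm. (3.1)(a), eq. (1.20)] -/
theorem taA_sectionFK (w : Sym2 V → unitInterval) (q : ℝ) (s y z x₀ v : V) (X : Set V) (hx₀ : x₀ ∈ X)
    (g : Set (Sym2 V) → ℝ) :
    taA w q s y z X g = (1 - (w s(x₀, v) : ℝ)) * taA (Function.update w s(x₀, v) 0) q s y z X g +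
      (w s(x₀, v) : ℝ) * taA (Function.update w s(x₀, v) 1) q s y z (insert v X) g := by
  rw [taA_absorb (Function.update w s(x₀, v) 1) q s y z x₀ v X hx₀ (by simp) g]
  unfold taA
  rw [Finset.mul_sum, Finset.mul_sum, ← Finset.sum_add_distrib]
  refine Finset.sum_congr rfl fun ω _ => ?_
  rw [rcWeightW_affine w q ∅ s(x₀, v) ω,
    ← taC_congr_off q s y X g (update_eq_off_cut w x₀ v X hx₀ 0 ω),
    ← taC_congr_off q s y X g (update_eq_off_cut w x₀ v X hx₀ 1 ω),
    ← taN_congr_off q s y X (update_eq_off_cut w x₀ v X hx₀ 0 ω),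
    ← taN_congr_off q s y X (update_eq_off_cut w x₀ v X hx₀ 1 ω),
    ← taNW_congr_off q s y z X (update_eq_off_cut w x₀ v X hx₀ 0 ω),
    ← taNW_congr_off q s y z X (update_eq_off_cut w x₀ v X hx₀ 1 ω)]
  ring

/-- Section identity for `b` (random-cluster weights). [cite: Grimmett2006, Thm. (3.1)(a), eq. (1.20)] -/
theorem tab_sectionFK (w : Sym2 V → unitInterval) (q : ℝ) (s y x₀ v : V) (X : Set V) (hx₀ : x₀ ∈ X) :
    tab w q s y X = (1 - (w s(x₀, v) : ℝ)) * tab (Function.update w s(x₀, v) 0) q s y X +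
      (w s(x₀, v) : ℝ) * tab (Function.update w s(x₀, v) 1) q s y (insert v X) := by
  rw [tab_absorb (Function.update w s(x₀, v) 1) q s y x₀ v X hx₀ (by simp)]
  unfold tab
  rw [Finset.mul_sum, Finset.mul_sum, ← Finset.sum_add_distrib]
  refine Finset.sum_congr rfl fun ω _ => ?_
  rw [rcWeightW_affine w q ∅ s(x₀, v) ω]
  ring

/-- Section identity for `a` (random-cluster weights). [cite: Grimmett2006, Thm. (3.1)(a), eq. (1.20)] -/
theorem taa_sectionFK (w : Sym2 V → unitInterval) (q : ℝ) (s y z x₀ v : V) (X : Set V) (hx₀ : x₀ ∈ X) :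
    taa w q s y z X = (1 - (w s(x₀, v) : ℝ)) * taa (Function.update w s(x₀, v) 0) q s y z X +
      (w s(x₀, v) : ℝ) * taa (Function.update w s(x₀, v) 1) q s y z (insert v X) := by
  rw [taa_absorb (Function.update w s(x₀, v) 1) q s y z x₀ v X hx₀ (by simp)]
  unfold taa
  rw [Finset.mul_sum, Finset.mul_sum, ← Finset.sum_add_distrib]
  refine Finset.sum_congr rfl fun ω _ => ?_
  rw [rcWeightW_affine w q ∅ s(x₀, v) ω]
  ring

end Sections

end Summit.CriticalPhenomena.PercolationContinuityZ3.Theorems.FK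

end
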